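/- WIDTH SEAT `ym-line-cbag-p1-w3` (prover-ym-line-cbag-p1-w3-g12-0), route `EguchiKawaiDirectionLadder` (ideator ym-idea-2, LINE 8),
crux `TripleSmallBallMargin` (stmt-QuantumFields-27724), LEAD g24's v7 architecture, stub S7 (E_rob): the RANK-ROBUST commutator
small-ball event (`W` Haar, `D ∈ U(N)` arbitrary) costs at most `33^{N²}(100/t²)^{sN}` times the PLAIN one — a COVERING argument
(Grassmannian net S6 + low-rank kill, both w5; volumetric net `BallNet`); no column engine.  ROUTE-INDEPENDENT (no Theses import).
Nothing here bears on the Yang–Mills mass gap (barrier-ledger line onto `EguchiKawaiBreakdown`). -/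
import Summits.QuantumFields.YangMills.Theorems.EguchiKawaiDirectionLadderLowRankKill
import Summits.QuantumFields.YangMills.Theorems.EguchiKawaiDirectionLadderGrassmannianNet
import Summits.QuantumFields.YangMills.Theorems.EguchiKawaiDirectionLadderRobustEvent
import Summits.QuantumFields.YangMills.Theorems.EguchiKawaiDirectionLadderRobustPairTransfer
import Summits.QuantumFields.YangMills.Theorems.EguchiKawaiDirectionLadderBallNet
import Mathlib.Analysis.InnerProductSpace.PiL2

/-!
# Route `EguchiKawaiDirectionLadder`, stub S7: rank-robust commutator events reduce to plain ones

**Theorem** (`haar_rankRobust_le`).  For `s ≤ N`, ANY unitary `D ∈ U(N)` and `0 < t ≤ 1`,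
`Haar{W ∈ U(N) : ∃ R, rank R ≤ s, ‖DW − WD − R‖_F² ≤ N t} ≤ 33^{N²}(100/t²)^{sN} · Haar{W : ‖DW − WD‖_F² ≤ 36 N t}`:
(E_rob) ⇐ (E) and, by Fubini over the first unitary in the role of `D`, (Ψ_rob) ⇐ (Ψ) (ARCH-27724-lead-g24 §3) with loss
`t^{−2sN} e^{O(N²)} = exp(N²(C − 2κ log t))` at rank `s = κN`.

**Proof** (covering; `a = N t`).  `M := W⋆DW − D`, so `DW − WD = W·M` and `M = S + L`, `‖S‖_F² ≤ a`, `rank L ≤ s`.  (1) A conjugate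
`P_c = V₀P₀V₀⋆` of the rank-`(N−s)` head projection kills `L` (`GrNet.exists_unitary_headProj_mul_eq_zero`): `‖M − (1−P_c)M‖_F² =
‖P_c S‖_F² ≤ a`.  (2) A Grassmannian net point `V` (`ρ = √t/2`, `#𝒩 ≤ 33^{N²}(4/t)^{(N−s)s}`): `‖(P_c′ − P_c)M‖_F² ≤ ρ²·4N = a`.
(3) `(1−P_c′)M = V·((1−P₀)V⋆M)`, a point of the `2√N`-ball of the last `s` rows `≅ ℝ^{2sN}`; a volumetric `√a`-net `𝓑`
(`#𝓑 ≤ (1+4/√t)^{2sN} ≤ (25/t)^{sN}`, `BallNet.exists_net`) gives `‖(1−P_c′)M − VB‖_F² ≤ a`.  (4) So `‖W⋆DW − D − VB‖_F² ≤ 9a`;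
with ONE representative unitary `X_{V,B}` per pair, `‖[D, WX⋆]‖_F² = ‖W⋆DW − X⋆DX‖_F² ≤ 36a`, i.e. `W ∈ E(36a)·X_{V,B}`;
right-invariance and the union bound over `𝒩 × 𝓑` finish.  [folklore]-level linear algebra on the tree's nets.

REMARK (why not the fixed-projection column engine): for `W = h(Λ + vv⋆)` one has `rank[Λ,W] ≤ 2` exactly while the weighted
lower-left blocks `Λ_k^{>}W_{>k,<k}` charged by the nested Gram–Schmidt engine are full-rank Cauchy-like matrices, so no
nested/interlaced column bound with `O(s)` dropped factors holds uniformly as `t → 0`; the covering route avoids this.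
-/

set_option autoImplicit false

noncomputable section

open MeasureTheory
open scoped Matrix Matrix.Norms.L2Operator
open Literature.Barriers.QuantumFields
open Literature.MathematicalPhysics.QuantumFieldTheory (haarProbability)

namespace Summit.QuantumFields.YangMills.Theorems.EguchiKawaiDirectionLadder

namespace RankRobust

/-! ### The tail-row net -/

/-- **Volumetric net for the last `s` rows.** For `R₀ ≥ 0`, `δ > 0` there is a finite set `𝓑` of `(r+s) × (r+s)` matrices,
`#𝓑 ≤ (1 + 2R₀/δ)^{2s(r+s)}`, such that for every `X` with `‖X‖_F ≤ R₀` some `B ∈ 𝓑` has `‖(1 − headProj r s)·X − B‖_F ≤ δ`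
(the last `s` rows of `X` form a point of the `R₀`-ball of `ℂ^{s×(r+s)} ≅ ℝ^{2s(r+s)}`; apply `BallNet.exists_net`). [folklore] -/
theorem exists_tail_net (r s : ℕ) {R₀ δ : ℝ} (hR : 0 ≤ R₀) (hδ : 0 < δ) :
    ∃ 𝓑 : Finset (Matrix (Fin (r + s)) (Fin (r + s)) ℂ),
      (𝓑.card : ℝ) ≤ (1 + 2 * R₀ / δ) ^ (2 * (s * (r + s))) ∧
      ∀ X : Matrix (Fin (r + s)) (Fin (r + s)) ℂ, frobSq X ≤ R₀ ^ 2 →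
        ∃ B ∈ 𝓑, frobSq ((1 - headProj r s) * X - B) ≤ δ ^ 2 := by
  classical
  let E := EuclideanSpace ℂ (Fin s × Fin (r + s))
  let τ : Matrix (Fin (r + s)) (Fin (r + s)) ℂ → E :=
    fun X => WithLp.toLp 2 (fun p : Fin s × Fin (r + s) => X (Fin.natAdd r p.1) p.2)
  let ι : E → Matrix (Fin (r + s)) (Fin (r + s)) ℂ := fun x a j =>
    Sum.elim (fun _ : Fin r => (0 : ℂ)) (fun i : Fin s => x (i, j)) (finSumFinEquiv.symm a)
  have hfin : Module.finrank ℝ E = 2 * (s * (r + s)) := by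
    rw [finrank_real_of_complex, finrank_euclideanSpace, Fintype.card_prod, Fintype.card_fin, Fintype.card_fin]
  -- `frobSq (ι z) = ‖z‖²`
  have hfrobι : ∀ z : E, frobSq (ι z) = ‖z‖ ^ 2 := by
    intro z
    rw [EuclideanSpace.norm_sq_eq, frobSq, Fin.sum_univ_add, Fintype.sum_prod_type]
    have h1 : ∑ i : Fin r, ∑ j, ‖ι z (Fin.castAdd s i) j‖ ^ 2 = 0 :=
      Finset.sum_eq_zero fun i _ => Finset.sum_eq_zero fun j _ => by simp [ι, finSumFinEquiv_symm_apply_castAdd]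
    have h2 : ∑ i : Fin s, ∑ j, ‖ι z (Fin.natAdd r i) j‖ ^ 2 = ∑ i : Fin s, ∑ j, ‖z (i, j)‖ ^ 2 :=
      Finset.sum_congr rfl fun i _ => Finset.sum_congr rfl fun j _ => by simp [ι, finSumFinEquiv_symm_apply_natAdd]
    rw [h1, h2, zero_add]
  -- `ι` is additive
  have hιsub : ∀ x y : E, ι x - ι y = ι (x - y) := by
    intro x y
    ext a j
    rw [Matrix.sub_apply]
    rcases h : finSumFinEquiv.symm a with i | i
    · simp [ι, h]
    · simp only [ι, h, Sum.elim_inr]; rfl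
  -- `(1 − headProj) X = ι (τ X)`
  have hιτ : ∀ X : Matrix (Fin (r + s)) (Fin (r + s)) ℂ, (1 - headProj r s) * X = ι (τ X) := by
    intro X
    ext a j
    rw [Matrix.sub_mul, Matrix.one_mul, Matrix.sub_apply, GrNet.headProj_eq_diagonal, Matrix.diagonal_mul]
    rcases h : finSumFinEquiv.symm a with i | i
    · simp [ι, h]
    · have ha : a = Fin.natAdd r i := by
        rw [← finSumFinEquiv_apply_right, ← h, Equiv.apply_symm_apply]
      simp [ι, τ, ha]
  -- `‖τ X‖² ≤ frobSq X`
  have hτle : ∀ X : Matrix (Fin (r + s)) (Fin (r + s)) ℂ, ‖τ X‖ ^ 2 ≤ frobSq X := by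
    intro X
    rw [EuclideanSpace.norm_sq_eq, frobSq, Fin.sum_univ_add, Fintype.sum_prod_type]
    have h2 : ∑ i : Fin s, ∑ j, ‖τ X (i, j)‖ ^ 2 = ∑ i : Fin s, ∑ j, ‖X (Fin.natAdd r i) j‖ ^ 2 :=
      Finset.sum_congr rfl fun i _ => Finset.sum_congr rfl fun j _ => by simp [τ]
    rw [h2]
    have h0 : 0 ≤ ∑ i : Fin r, ∑ j, ‖X (Fin.castAdd s i) j‖ ^ 2 :=
      Finset.sum_nonneg fun i _ => Finset.sum_nonneg fun j _ => by positivity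
    linarith
  obtain ⟨S, hcard, -, hnet⟩ := BallNet.exists_net (E := E) hR hδ
  refine ⟨S.image ι, ?_, ?_⟩
  · calc ((S.image ι).card : ℝ) ≤ S.card := by exact_mod_cast Finset.card_image_le
      _ ≤ (1 + 2 * R₀ / δ) ^ Module.finrank ℝ E := hcard
      _ = (1 + 2 * R₀ / δ) ^ (2 * (s * (r + s))) := by rw [hfin]
  · intro X hX
    have hτR : ‖τ X‖ ≤ R₀ := by
      have h := (hτle X).trans hX
      exact (pow_le_pow_iff_left₀ (norm_nonneg _) hR two_ne_zero).1 h
    obtain ⟨y, hy, hxy⟩ := hnet (τ X) hτR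
    refine ⟨ι y, Finset.mem_image_of_mem ι hy, ?_⟩
    rw [hιτ, hιsub, hfrobι]
    exact pow_le_pow_left₀ (norm_nonneg _) hxy 2

/-! ### The reduction -/

/-- **Rank-robust reduction, `N = r + s` form.**  For `D ∈ U(r+s)` and `0 < t ≤ 1`:
`Haar{W : ∃ R, rank R ≤ s, ‖DW − WD − R‖_F² ≤ (r+s)t} ≤ 33^{(r+s)²}(100/t²)^{s(r+s)} · Haar{W : ‖DW − WD‖_F² ≤ 36(r+s)t}`.
[folklore] -/
theorem haar_rankRobust_le_aux (r s : ℕ) (D : Matrix.unitaryGroup (Fin (r + s)) ℂ) {t : ℝ} (ht : 0 < t) (ht1 : t ≤ 1) :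
    haarProbability (Matrix.unitaryGroup (Fin (r + s)) ℂ)
        {W | ∃ R : Matrix (Fin (r + s)) (Fin (r + s)) ℂ, R.rank ≤ s ∧
          frobSq ((D : Matrix (Fin (r + s)) (Fin (r + s)) ℂ) * (W : Matrix (Fin (r + s)) (Fin (r + s)) ℂ) -
            (W : Matrix (Fin (r + s)) (Fin (r + s)) ℂ) * (D : Matrix (Fin (r + s)) (Fin (r + s)) ℂ) - R) ≤
              ((r + s : ℕ) : ℝ) * t} ≤
      ENNReal.ofReal ((33 : ℝ) ^ ((r + s) * (r + s)) * (100 / t ^ 2) ^ (s * (r + s))) *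
        haarProbability (Matrix.unitaryGroup (Fin (r + s)) ℂ)
          {W | frobSq ((D : Matrix (Fin (r + s)) (Fin (r + s)) ℂ) * (W : Matrix (Fin (r + s)) (Fin (r + s)) ℂ) -
            (W : Matrix (Fin (r + s)) (Fin (r + s)) ℂ) * (D : Matrix (Fin (r + s)) (Fin (r + s)) ℂ)) ≤
              36 * (((r + s : ℕ) : ℝ) * t)} := by
  classical
  set μ := haarProbability (Matrix.unitaryGroup (Fin (r + s)) ℂ) with hμ
  haveI : IsProbabilityMeasure μ := by rw [hμ]; infer_instance
  haveI : μ.IsMulRightInvariant := isMulRightInvariant_haarUN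
  set Dm : Matrix (Fin (r + s)) (Fin (r + s)) ℂ := (D : Matrix (Fin (r + s)) (Fin (r + s)) ℂ) with hDm
  set a : ℝ := ((r + s : ℕ) : ℝ) * t with ha
  -- the constant is at least `1`
  have hconst1 : (1 : ℝ) ≤ (33 : ℝ) ^ ((r + s) * (r + s)) * (100 / t ^ 2) ^ (s * (r + s)) := by
    have h1 : (1 : ℝ) ≤ (33 : ℝ) ^ ((r + s) * (r + s)) := one_le_pow₀ (by norm_num)
    have h2 : (1 : ℝ) ≤ (100 / t ^ 2) ^ (s * (r + s)) :=
      one_le_pow₀ (by rw [le_div_iff₀ (by positivity)]; nlinarith)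
    nlinarith
  -- degenerate dimension `r + s = 0`: the plain event is everything
  rcases Nat.eq_zero_or_pos (r + s) with h0 | hpos
  · have hE : {W : Matrix.unitaryGroup (Fin (r + s)) ℂ |
        frobSq (Dm * (W : Matrix (Fin (r + s)) (Fin (r + s)) ℂ) -
          (W : Matrix (Fin (r + s)) (Fin (r + s)) ℂ) * Dm) ≤ 36 * a} = Set.univ := by
      refine Set.eq_univ_of_forall fun W => ?_
      have hempty : IsEmpty (Fin (r + s)) := ⟨fun i => absurd i.2 (by omega)⟩
      show frobSq _ ≤ 36 * a
      rw [frobSq, Finset.univ_eq_empty, Finset.sum_empty, ha, h0]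
      simp
    rw [hE, measure_univ, mul_one]
    exact prob_le_one.trans (ENNReal.ofReal_one.symm.trans_le (ENNReal.ofReal_le_ofReal hconst1))
  -- positive dimension
  have hnpos : (0 : ℝ) < ((r + s : ℕ) : ℝ) := by exact_mod_cast hpos
  have hapos : 0 < a := by rw [ha]; positivity
  -- Grassmannian net at `ρ = √t / 2`
  set ρ : ℝ := Real.sqrt t / 2 with hρ
  have hsqrt_pos : 0 < Real.sqrt t := Real.sqrt_pos.2 ht
  have hsqrt_le : Real.sqrt t ≤ 1 := by rw [← Real.sqrt_one]; exact Real.sqrt_le_sqrt ht1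
  have hρ0 : 0 < ρ := by positivity
  have hρ1 : ρ ≤ 1 := by rw [hρ]; linarith
  obtain ⟨𝒩, h𝒩card, h𝒩net⟩ := GrNet.exists_grassmannian_net r s hρ0 hρ1
  -- tail net at radius `2√(r+s)`, mesh `√a`
  obtain ⟨𝓑, h𝓑card, h𝓑net⟩ := exists_tail_net r s (R₀ := 2 * Real.sqrt ((r + s : ℕ) : ℝ)) (δ := Real.sqrt a)
    (by positivity) (Real.sqrt_pos.2 hapos)
  have hR0sq : (2 * Real.sqrt ((r + s : ℕ) : ℝ)) ^ 2 = 4 * ((r + s : ℕ) : ℝ) := by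
    rw [mul_pow, Real.sq_sqrt hnpos.le]; ring
  have hδsq : Real.sqrt a ^ 2 = a := Real.sq_sqrt hapos.le
  -- representatives: one unitary per net pair
  let Q : Matrix.unitaryGroup (Fin (r + s)) ℂ × Matrix (Fin (r + s)) (Fin (r + s)) ℂ →
      Matrix.unitaryGroup (Fin (r + s)) ℂ → Prop := fun p X =>
    frobSq (star (X : Matrix (Fin (r + s)) (Fin (r + s)) ℂ) * Dm * (X : Matrix (Fin (r + s)) (Fin (r + s)) ℂ) - Dm -
      (p.1 : Matrix (Fin (r + s)) (Fin (r + s)) ℂ) * p.2) ≤ 9 * a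
  let rep : Matrix.unitaryGroup (Fin (r + s)) ℂ × Matrix (Fin (r + s)) (Fin (r + s)) ℂ →
      Matrix.unitaryGroup (Fin (r + s)) ℂ := fun p => if h : ∃ X, Q p X then Classical.choose h else 1
  have hrep : ∀ p, (h : ∃ X, Q p X) → Q p (rep p) := by
    intro p h
    simp only [rep, dif_pos h]
    exact Classical.choose_spec h
  -- the plain event
  set E36 : Set (Matrix.unitaryGroup (Fin (r + s)) ℂ) := {Y |
    frobSq (Dm * (Y : Matrix (Fin (r + s)) (Fin (r + s)) ℂ) - (Y : Matrix (Fin (r + s)) (Fin (r + s)) ℂ) * Dm) ≤ 36 * a}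
    with hE36
  -- unitary bookkeeping
  have hUU : ∀ U : Matrix.unitaryGroup (Fin (r + s)) ℂ, (U : Matrix (Fin (r + s)) (Fin (r + s)) ℂ) *
      star (U : Matrix (Fin (r + s)) (Fin (r + s)) ℂ) = 1 := fun U => Matrix.mem_unitaryGroup_iff.mp U.2
  have hUU' : ∀ U : Matrix.unitaryGroup (Fin (r + s)) ℂ, star (U : Matrix (Fin (r + s)) (Fin (r + s)) ℂ) *
      (U : Matrix (Fin (r + s)) (Fin (r + s)) ℂ) = 1 := fun U => Matrix.mem_unitaryGroup_iff'.mp U.2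
  have hcoe_star : ∀ U : Matrix.unitaryGroup (Fin (r + s)) ℂ,
      ((star U : Matrix.unitaryGroup (Fin (r + s)) ℂ) : Matrix (Fin (r + s)) (Fin (r + s)) ℂ) =
        star (U : Matrix (Fin (r + s)) (Fin (r + s)) ℂ) := fun U => rfl
  have hfrob_left : ∀ (U : Matrix.unitaryGroup (Fin (r + s)) ℂ) (Y : Matrix (Fin (r + s)) (Fin (r + s)) ℂ),
      frobSq (star (U : Matrix (Fin (r + s)) (Fin (r + s)) ℂ) * Y) = frobSq Y := fun U Y => by
    rw [← hcoe_star]; exact sum_norm_sq_unitary_mul (star U) Y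
  have hfrob_left' : ∀ (U : Matrix.unitaryGroup (Fin (r + s)) ℂ) (Y : Matrix (Fin (r + s)) (Fin (r + s)) ℂ),
      frobSq ((U : Matrix (Fin (r + s)) (Fin (r + s)) ℂ) * Y) = frobSq Y :=
    fun U Y => sum_norm_sq_unitary_mul U Y
  have hfrob_right : ∀ (Y : Matrix (Fin (r + s)) (Fin (r + s)) ℂ) (U : Matrix.unitaryGroup (Fin (r + s)) ℂ),
      frobSq (Y * (U : Matrix (Fin (r + s)) (Fin (r + s)) ℂ)) = frobSq Y :=
    fun Y U => sum_norm_sq_mul_unitary Y U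
  -- THE COVERING
  have hcover : {W : Matrix.unitaryGroup (Fin (r + s)) ℂ | ∃ R : Matrix (Fin (r + s)) (Fin (r + s)) ℂ, R.rank ≤ s ∧
        frobSq (Dm * (W : Matrix (Fin (r + s)) (Fin (r + s)) ℂ) - (W : Matrix (Fin (r + s)) (Fin (r + s)) ℂ) * Dm - R) ≤ a} ⊆
      ⋃ p ∈ 𝒩 ×ˢ 𝓑, (fun W : Matrix.unitaryGroup (Fin (r + s)) ℂ => W * (rep p)⁻¹) ⁻¹' E36 := by
    rintro W ⟨R, hR, hWR⟩
    set Wm : Matrix (Fin (r + s)) (Fin (r + s)) ℂ := (W : Matrix (Fin (r + s)) (Fin (r + s)) ℂ) with hWm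
    -- `M = W⋆DW − D = S + L`
    set M : Matrix (Fin (r + s)) (Fin (r + s)) ℂ := star Wm * Dm * Wm - Dm with hM
    set L : Matrix (Fin (r + s)) (Fin (r + s)) ℂ := star Wm * R with hL
    set S : Matrix (Fin (r + s)) (Fin (r + s)) ℂ := M - L with hS
    have hML : M = S + L := by rw [hS, sub_add_cancel]
    have hSeq : S = star Wm * (Dm * Wm - Wm * Dm - R) := by
      rw [hS, hM, hL]
      have : star Wm * (Dm * Wm - Wm * Dm - R) = star Wm * Dm * Wm - (star Wm * Wm) * Dm - star Wm * R := by
        noncomm_ring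
      rw [this, hUU' W, one_mul]
    have hSa : frobSq S ≤ a := by rw [hSeq, hfrob_left]; exact hWR
    have hLrank : L.rank ≤ s := by
      rw [hL, ← hcoe_star, Matrix.rank_mul_eq_right_of_isUnit_det _ _ (isUnit_det_coe (star W))]
      exact hR
    have hMle : frobSq M ≤ 4 * ((r + s : ℕ) : ℝ) := by
      have h1 : frobSq (star Wm * Dm * Wm) = ((r + s : ℕ) : ℝ) := frobSq_unitary (star W * D * W)
      have h2 : frobSq Dm = ((r + s : ℕ) : ℝ) := frobSq_unitary D
      calc frobSq M ≤ 2 * frobSq (star Wm * Dm * Wm) + 2 * frobSq Dm := frobSq_sub_le _ _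
        _ = 4 * ((r + s : ℕ) : ℝ) := by rw [h1, h2]; ring
    -- (1) the adapted projection
    obtain ⟨V₀, hV₀⟩ := GrNet.exists_unitary_headProj_mul_eq_zero L hLrank
    set V₀m : Matrix (Fin (r + s)) (Fin (r + s)) ℂ := (V₀ : Matrix (Fin (r + s)) (Fin (r + s)) ℂ) with hV₀m
    set Pc : Matrix (Fin (r + s)) (Fin (r + s)) ℂ := V₀m * headProj r s * V₀mᴴ with hPc
    have hV₀star : V₀mᴴ = ((star V₀ : Matrix.unitaryGroup (Fin (r + s)) ℂ) : Matrix (Fin (r + s)) (Fin (r + s)) ℂ) := by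
      rw [hcoe_star, Matrix.star_eq_conjTranspose]
    have hPcL : Pc * L = 0 := by
      rw [hPc, Matrix.mul_assoc, Matrix.mul_assoc, hV₀star, hV₀, Matrix.mul_zero]
    have h1eq : M - (1 - Pc) * M = Pc * S := by
      rw [Matrix.sub_mul, Matrix.one_mul, sub_sub_cancel, hML, Matrix.mul_add, hPcL, add_zero]
    have h1 : frobSq (M - (1 - Pc) * M) ≤ a := by
      rw [h1eq]
      calc frobSq (Pc * S) ≤ ‖Pc‖ ^ 2 * frobSq S := frobSq_mul_le _ _
        _ ≤ 1 ^ 2 * frobSq S := by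
            refine mul_le_mul_of_nonneg_right ?_ (frobSq_nonneg _)
            exact pow_le_pow_left₀ (norm_nonneg _) (GrNet.norm_conjProj_le_one V₀) 2
        _ ≤ a := by rw [one_pow, one_mul]; exact hSa
    -- (2) the net point
    obtain ⟨V, hV, hV₀V⟩ := h𝒩net V₀
    set Vm : Matrix (Fin (r + s)) (Fin (r + s)) ℂ := (V : Matrix (Fin (r + s)) (Fin (r + s)) ℂ) with hVm
    set Pc' : Matrix (Fin (r + s)) (Fin (r + s)) ℂ := Vm * headProj r s * Vmᴴ with hPc'
    have h2eq : (1 - Pc) * M - (1 - Pc') * M = (Pc' - Pc) * M := by noncomm_ring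
    have hρsq : ρ ^ 2 = t / 4 := by rw [hρ, div_pow, Real.sq_sqrt ht.le]; norm_num
    have h2 : frobSq ((1 - Pc) * M - (1 - Pc') * M) ≤ a := by
      rw [h2eq]
      calc frobSq ((Pc' - Pc) * M) ≤ ‖Pc' - Pc‖ ^ 2 * frobSq M := frobSq_mul_le _ _
        _ ≤ ρ ^ 2 * (4 * ((r + s : ℕ) : ℝ)) := by
            refine mul_le_mul ?_ hMle (frobSq_nonneg _) (sq_nonneg _)
            have : ‖Pc' - Pc‖ ≤ ρ := by rw [norm_sub_rev]; exact hV₀V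
            exact pow_le_pow_left₀ (norm_nonneg _) this 2
        _ = a := by rw [hρsq, ha]; ring
    -- (3) the tail net
    set Xm : Matrix (Fin (r + s)) (Fin (r + s)) ℂ := Vmᴴ * M with hXm
    have hVstar : Vmᴴ = star Vm := (Matrix.star_eq_conjTranspose Vm).symm
    have hXle : frobSq Xm ≤ (2 * Real.sqrt ((r + s : ℕ) : ℝ)) ^ 2 := by
      rw [hR0sq, hXm, hVstar, hfrob_left]; exact hMle
    obtain ⟨B, hB, hXB⟩ := h𝓑net Xm hXle
    have h3eq : (1 - Pc') * M - Vm * B = Vm * ((1 - headProj r s) * Xm - B) := by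
      have hVV : Vm * Vmᴴ = 1 := by rw [hVstar]; exact hUU V
      rw [hXm, hPc']
      calc (1 - Vm * headProj r s * Vmᴴ) * M - Vm * B
          = (Vm * Vmᴴ - Vm * headProj r s * Vmᴴ) * M - Vm * B := by rw [hVV]
        _ = Vm * ((1 - headProj r s) * (Vmᴴ * M) - B) := by noncomm_ring
    have h3 : frobSq ((1 - Pc') * M - Vm * B) ≤ a := by
      rw [h3eq, hfrob_left', ← hδsq]; exact hXB
    -- (4) `‖M − V B‖_F² ≤ 9a`
    have h4 : frobSq (M - Vm * B) ≤ 9 * a := by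
      have hsplit : M - Vm * B = (M - (1 - Pc) * M) + ((1 - Pc) * M - (1 - Pc') * M) + ((1 - Pc') * M - Vm * B) := by
        abel
      rw [hsplit]
      refine (sum_norm_sq_add_three_le _ _ _).trans ?_
      have := frobSq_nonneg (M - (1 - Pc) * M)
      change 3 * (frobSq (M - (1 - Pc) * M) + frobSq ((1 - Pc) * M - (1 - Pc') * M) +
        frobSq ((1 - Pc') * M - Vm * B)) ≤ 9 * a
      linarith
    -- the representative of the pair `(V, B)`
    set p : Matrix.unitaryGroup (Fin (r + s)) ℂ × Matrix (Fin (r + s)) (Fin (r + s)) ℂ := (V, B) with hp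
    have hQW : Q p W := by
      show frobSq (star Wm * Dm * Wm - Dm - Vm * B) ≤ 9 * a
      exact h4
    have hQX := hrep p ⟨W, hQW⟩
    set X := rep p with hX
    set Xm' : Matrix (Fin (r + s)) (Fin (r + s)) ℂ := (X : Matrix (Fin (r + s)) (Fin (r + s)) ℂ) with hXm'
    set MX : Matrix (Fin (r + s)) (Fin (r + s)) ℂ := star Xm' * Dm * Xm' - Dm with hMX
    have hQX' : frobSq (MX - Vm * B) ≤ 9 * a := by
      have : MX - Vm * B = star Xm' * Dm * Xm' - Dm - Vm * B := by rw [hMX]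
      rw [this]; exact hQX
    have h5 : frobSq (M - MX) ≤ 36 * a := by
      have : M - MX = (M - Vm * B) - (MX - Vm * B) := by abel
      rw [this]
      refine (frobSq_sub_le _ _).trans ?_
      linarith
    -- (5) `W X⁻¹ ∈ E36`
    refine Set.mem_iUnion₂.2 ⟨p, Finset.mem_product.2 ⟨hV, hB⟩, ?_⟩
    rw [Set.mem_preimage, hE36, Set.mem_setOf_eq]
    have hcoeY : ((W * X⁻¹ : Matrix.unitaryGroup (Fin (r + s)) ℂ) : Matrix (Fin (r + s)) (Fin (r + s)) ℂ) =
        Wm * star Xm' := by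
      rw [Matrix.UnitaryGroup.mul_val, Matrix.UnitaryGroup.inv_val]
    rw [hcoeY]
    have hkey : star Wm * (Dm * (Wm * star Xm') - Wm * star Xm' * Dm) * Xm' = M - MX := by
      rw [hM, hMX]
      have e : star Wm * (Dm * (Wm * star Xm') - Wm * star Xm' * Dm) * Xm' =
          star Wm * Dm * Wm * (star Xm' * Xm') - (star Wm * Wm) * (star Xm' * Dm * Xm') := by noncomm_ring
      rw [e, hUU' X, hUU' W, Matrix.mul_one, Matrix.one_mul]
      abel
    calc frobSq (Dm * (Wm * star Xm') - Wm * star Xm' * Dm)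
        = frobSq (star Wm * (Dm * (Wm * star Xm') - Wm * star Xm' * Dm) * Xm') := by
          rw [hfrob_right, hfrob_left]
      _ = frobSq (M - MX) := by rw [hkey]
      _ ≤ 36 * a := h5
  -- THE COUNT
  have hcardR : (((𝒩 ×ˢ 𝓑).card : ℕ) : ℝ) ≤ (33 : ℝ) ^ ((r + s) * (r + s)) * (100 / t ^ 2) ^ (s * (r + s)) := by
    rw [Finset.card_product, Nat.cast_mul]
    have hA : (𝒩.card : ℝ) ≤ (33 : ℝ) ^ ((r + s) * (r + s)) * (4 / t) ^ (s * (r + s)) := by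
      refine h𝒩card.trans ?_
      refine mul_le_mul_of_nonneg_left ?_ (by positivity)
      have hρinv : ρ⁻¹ ^ (2 * r * s) = (4 / t) ^ (r * s) := by
        rw [show 2 * r * s = 2 * (r * s) by ring, pow_mul]
        congr 1
        rw [hρ, inv_div, div_pow, Real.sq_sqrt ht.le]
        field_simp
        norm_num
      rw [hρinv]
      refine pow_le_pow_right₀ ?_ ?_
      · rw [le_div_iff₀ ht]; linarith
      · nlinarith
    have hB : (𝓑.card : ℝ) ≤ (25 / t) ^ (s * (r + s)) := by
      refine h𝓑card.trans ?_
      have hratio : 2 * (2 * Real.sqrt ((r + s : ℕ) : ℝ)) / Real.sqrt a = 4 / Real.sqrt t := by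
        rw [ha, Real.sqrt_mul hnpos.le]
        have hs0 : Real.sqrt ((r + s : ℕ) : ℝ) ≠ 0 := (Real.sqrt_pos.2 hnpos).ne'
        field_simp
        ring
      rw [hratio, pow_mul]
      refine pow_le_pow_left₀ (by positivity) ?_ _
      have hst : 0 < Real.sqrt t := hsqrt_pos
      have h1 : 1 + 4 / Real.sqrt t ≤ 5 / Real.sqrt t := by
        have h1' : (1 : ℝ) ≤ 1 / Real.sqrt t := by
          rw [le_div_iff₀ hst]; linarith
        calc 1 + 4 / Real.sqrt t ≤ 1 / Real.sqrt t + 4 / Real.sqrt t := by linarith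
          _ = 5 / Real.sqrt t := by ring
      have h2 : (5 / Real.sqrt t) ^ 2 = 25 / t := by rw [div_pow, Real.sq_sqrt ht.le]; norm_num
      calc (1 + 4 / Real.sqrt t) ^ 2 ≤ (5 / Real.sqrt t) ^ 2 := pow_le_pow_left₀ (by positivity) h1 2
        _ = 25 / t := h2
    calc (𝒩.card : ℝ) * (𝓑.card : ℝ)
        ≤ ((33 : ℝ) ^ ((r + s) * (r + s)) * (4 / t) ^ (s * (r + s))) * (25 / t) ^ (s * (r + s)) :=
          mul_le_mul hA hB (Nat.cast_nonneg _) (by positivity)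
      _ = (33 : ℝ) ^ ((r + s) * (r + s)) * (100 / t ^ 2) ^ (s * (r + s)) := by
          rw [mul_assoc, ← mul_pow]
          congr 2
          field_simp
          norm_num
  -- ASSEMBLE
  calc μ {W : Matrix.unitaryGroup (Fin (r + s)) ℂ | ∃ R : Matrix (Fin (r + s)) (Fin (r + s)) ℂ, R.rank ≤ s ∧
          frobSq (Dm * (W : Matrix (Fin (r + s)) (Fin (r + s)) ℂ) - (W : Matrix (Fin (r + s)) (Fin (r + s)) ℂ) * Dm - R) ≤ a}
      ≤ μ (⋃ p ∈ 𝒩 ×ˢ 𝓑, (fun W : Matrix.unitaryGroup (Fin (r + s)) ℂ => W * (rep p)⁻¹) ⁻¹' E36) := measure_mono hcover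
    _ ≤ ∑ p ∈ 𝒩 ×ˢ 𝓑, μ ((fun W : Matrix.unitaryGroup (Fin (r + s)) ℂ => W * (rep p)⁻¹) ⁻¹' E36) :=
        measure_biUnion_finset_le _ _
    _ = ∑ p ∈ 𝒩 ×ˢ 𝓑, μ E36 := by
        refine Finset.sum_congr rfl fun p _ => ?_
        exact measure_preimage_mul_right μ (rep p)⁻¹ E36
    _ = ((𝒩 ×ˢ 𝓑).card : ENNReal) * μ E36 := by rw [Finset.sum_const, nsmul_eq_mul]
    _ ≤ ENNReal.ofReal ((33 : ℝ) ^ ((r + s) * (r + s)) * (100 / t ^ 2) ^ (s * (r + s))) * μ E36 := by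
        gcongr
        rw [← ENNReal.ofReal_natCast]
        exact ENNReal.ofReal_le_ofReal hcardR

/-- **Rank-robust reduction (stub S7 of the v7 architecture of stmt-QuantumFields-27724).**  For `s ≤ N`, ANY unitary
`D ∈ U(N)` and `0 < t ≤ 1`,
`Haar{W ∈ U(N) : ∃ R, rank R ≤ s ∧ ‖DW − WD − R‖_F² ≤ N t} ≤ 33^{N²} · (100/t²)^{sN} · Haar{W ∈ U(N) : ‖DW − WD‖_F² ≤ 36 N t}`:
the rank-robust commutator small-ball event costs at most `t^{−2sN} e^{O(N²)}` more than the plain one.  With `D` the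
eigenvalue diagonal of a first unitary this is (E_rob) ⇐ (E); with `D` the first unitary itself and Fubini it is
(Ψ_rob) ⇐ (Ψ). [folklore] -/
theorem haar_rankRobust_le {N s : ℕ} (hs : s ≤ N) (D : Matrix.unitaryGroup (Fin N) ℂ) {t : ℝ} (ht : 0 < t)
    (ht1 : t ≤ 1) :
    haarProbability (Matrix.unitaryGroup (Fin N) ℂ)
        {W | ∃ R : Matrix (Fin N) (Fin N) ℂ, R.rank ≤ s ∧
          frobSq ((D : Matrix (Fin N) (Fin N) ℂ) * (W : Matrix (Fin N) (Fin N) ℂ) -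
            (W : Matrix (Fin N) (Fin N) ℂ) * (D : Matrix (Fin N) (Fin N) ℂ) - R) ≤ (N : ℝ) * t} ≤
      ENNReal.ofReal ((33 : ℝ) ^ (N * N) * (100 / t ^ 2) ^ (s * N)) *
        haarProbability (Matrix.unitaryGroup (Fin N) ℂ)
          {W | frobSq ((D : Matrix (Fin N) (Fin N) ℂ) * (W : Matrix (Fin N) (Fin N) ℂ) -
            (W : Matrix (Fin N) (Fin N) ℂ) * (D : Matrix (Fin N) (Fin N) ℂ)) ≤ 36 * ((N : ℝ) * t)} := by
  obtain ⟨r, rfl⟩ : ∃ r, N = r + s := ⟨N - s, by omega⟩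
  exact haar_rankRobust_le_aux r s D ht ht1

end RankRobust

end Summit.QuantumFields.YangMills.Theorems.EguchiKawaiDirectionLadder

end
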